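import Summits.BirchSwinnertonDyer.Rank1Residual.X11b.BDPRouteLevelToKummer
import Summits.BirchSwinnertonDyer.Rank1Residual.X11b.BDPRouteLocalIndexSymmetry
import Summits.BirchSwinnertonDyer.Rank1Residual.X11b.BDPRouteLocalIndex
import HarnessLib

/-!
# X11b, route p2 — the `K_𝔭 ≅ ℚ_p` TRANSPORT of the local index, the (iv)-vanishing at `𝔭`, and
# `ord_p ∏_{w ∣ p} c_w(E/K) = 2 ord_p c_p(E)` (plumbing items (iii), (G4), (v) of the input (d))

HONEST FRAMING (cell `b2b-bsdres`, run/shared/lean/b2b/bsd-rank1-residual/, verbatim in every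
file): the goal of the cell is to DELETE the COMBINATION-SHAPED residual classes of the
Birch–Swinnerton-Dyer formula for ALL analytic-rank `≤ 1` elliptic curves over `ℚ` — "full BSD
formula for every rank `≤ 1` curve in class `C`" assembled STRICTLY from published theorems — so
that the rank-`≤ 1` remainder becomes exactly the CONSTRUCTION-SHAPED classes, which are TYPED
(missing-input `Prop`s), NOT attempted. This is not "finishing BSD". Sub-cell
`b2b-bsdres-multr1-p2` (X11b, route p2 = BDP + converse + Kolyvagin; the JSW17 Prop. 3.2.1 "≤"
half (d) `P2SelmerCardBoundAt`); a RESEARCH ROUTE; no claim beyond the stated class; X11b stays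
CONSTRUCTION-SHAPED; nothing here changes a label; no named fact is minted (two plumbing
definitions with bodies — the `ℚ`-algebra isomorphism `K_𝔭 ≃ ℚ_p` behind `embAt` and the induced
transport of points — and theorems; no `sorry`).

## What is here

The finite-level pieces of (d) (Parts A/B `BDPRouteStrictAtPlace` / `BDPRouteRelaxation`, the
glue `BDPRouteLevelToKummer`) speak about `E(K_𝔭)`, `E(K_𝔭̄)` and `im E(K)`; the local index
theorem `BDPRouteLocalIndex` speaks about `E(ℚ_p)` and the image `P_ι` of a point along THE
embedding `ι = embAt K p 𝔭`. This file supplies the dictionary: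

* `padicAlgEquiv K p 𝔭 … : K_𝔭 ≃ₐ[ℚ] ℚ_[p]` with `embAt = padicAlgEquiv ∘ (K → K_𝔭)`
  (`embAt_eq_comp`), and the induced `pointTransportPadic : E(K_𝔭) ≃+ E(ℚ_p)` carrying the image
  of `P ∈ E(K)` to `padicPointOf W p (embAt …) P` (`pointTransportPadic_baseChange`);
* **`index_range_baseChange_sup_eq_padic`**: `[E(K_𝔭) : nE(K_𝔭) + im E(K)] = [E(ℚ_p) : nE(ℚ_p) + im_ι E(K)]`
  and `index_range_zsmul_eq_padic`: `[E(K_𝔭) : nE(K_𝔭)] = [E(ℚ_p) : nE(ℚ_p)]` (item (iii));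
* **`eq_zero_of_forall_restrictField_eq`** (item (G4)): if `E(K_𝔭)[p] = 0` (e.g. from (iv)
  `E(ℚ_p)[p] = 0`, `noPTorsion_baseChange_adicCompletion_of_padic`), a point of `E[p^∞](K̄)` fixed
  by `Γ_{K_𝔭}` (acting through `absGaloisRestrict`, i.e. by the decomposition group `D_𝔭`) is `0`
  — the hypothesis `hΓ` of `LevelKummer.selmerGroup_acLevelStructure_le_inf`;
* **`exists_conj_prime_of_splitsIn`**: for `[K:ℚ] = 2` and `p` split, the primes above `p` are
  `𝔭` and `σ • 𝔭 ≠ 𝔭` for some `σ ∈ Aut(K/ℚ)`, both of degree one;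
* **`padicValNat_tamagawaProductAbove_eq_two_mul`** (item (v)): for `[K:ℚ] = 2`, `p` split and
  `W/ℚ` elliptic, `ord_p ∏_{w∣p} c_w(E/K) = 2 · ord_p c_p(E)` with `c_p` the `ℤ_p`-Tamagawa number
  of `W ⊗ ℚ_p` (`c_w(E_K) = c_p(E)` at a degree-one `w`, `localTamagawaNumber_baseChange_eq_of_degree_one`
  + `localTamagawaNumber_padic_eq_holds`).

References: [Castella2018] §2.2 and proof of Thm. 2.3 ((3.2.1), (calcul)), arXiv:1704.06608
pp. 5–6; [JetchevSkinnerWan2017] Prop. 3.2.1 and (7.1.5); [CasselsFrohlichANT1967] Ch. II §10;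
[SilvermanAEC2009] VII.6 Ex. 7.6, VIII.§1.
-/

noncomputable section

open scoped Classical

universe u

namespace Summit.BirchSwinnertonDyer.Rank1Residual.X11b.LocalIndexTransport

open WeierstrassCurve NumberField IsDedekindDomain Field
open Literature.NumberTheory.EllipticCurves Literature.NumberTheory.EllipticCurves.GreenbergSelmer
open Literature.NumberTheory.GaloisRepresentations Literature.NumberTheory.Automorphic
open Literature.Barriers.BirchSwinnertonDyer
open Summit.BirchSwinnertonDyer.Rank1Residual.X11b.AcSelmer
open Summit.BirchSwinnertonDyer.Rank1Residual.X11b.LocBridge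

/-! ## §1. `K_𝔭 ≃ₐ[ℚ] ℚ_p` at a degree-one prime and the transport of points -/

section Transport

variable (K : Type) [Field K] [NumberField K] (p : ℕ) [Fact p.Prime]
  (𝔭 : HeightOneSpectrum (𝓞 K)) (h𝔭 : ((p : ℕ) : 𝓞 K) ∈ 𝔭.asIdeal)
  (he : 𝔭.asIdeal.ramificationIdx (𝓞 ℚ) = 1) (hf : 𝔭.asIdeal.inertiaDeg (𝓞 ℚ) = 1)

/-- The ring isomorphism `K_𝔭 ≃+* ℚ_p` at a degree-one prime `𝔭 ∣ p`: the inverse of the tree's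
`adicCompletionEquivOfDegreeOne ℚ K v 𝔭` (`v` the place of `ℚ` at `p`) followed by the inverse of
Mathlib's `Padic.adicCompletionEquiv` — the two isomorphisms behind `embAt`. [folklore] -/
def padicRingEquiv : 𝔭.adicCompletion K ≃+* ℚ_[p] :=
  haveI : 𝔭.asIdeal.LiesOver (ratPlace p).asIdeal := ⟨by rw [← under_eq_ratPlace_of_mem h𝔭]; rfl⟩
  (adicCompletionEquivOfDegreeOne ℚ K (ratPlace p) 𝔭 he hf).symm.trans
    (Padic.adicCompletionEquiv (𝓞 ℚ) ⟨p, Fact.out⟩).symm.toAlgEquiv.toRingEquiv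

/-- `K_𝔭 ≃ₐ[ℚ] ℚ_p` (any ring isomorphism of `ℚ`-algebras of characteristic `0` is `ℚ`-linear:
`ℚ →+* ℚ_p` is unique). [folklore] -/
def padicAlgEquiv : 𝔭.adicCompletion K ≃ₐ[ℚ] ℚ_[p] :=
  AlgEquiv.ofRingEquiv (f := padicRingEquiv K p 𝔭 h𝔭 he hf) fun x =>
    RingHom.congr_fun
      (Subsingleton.elim ((padicRingEquiv K p 𝔭 h𝔭 he hf).toRingHom.comp
        (algebraMap ℚ (𝔭.adicCompletion K))) (algebraMap ℚ ℚ_[p])) x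

/-- **`embAt = (K_𝔭 ≃ ℚ_p) ∘ (K → K_𝔭)`** (definitional). [folklore] -/
theorem embAt_eq_comp :
    embAt K p 𝔭 h𝔭 he hf =
      (padicAlgEquiv K p 𝔭 h𝔭 he hf).toAlgHom.toRingHom.comp (algebraMap K (𝔭.adicCompletion K)) :=
  rfl

/-- Pointwise form of `embAt_eq_comp`. [folklore] -/
theorem embAt_apply (x : K) :
    embAt K p 𝔭 h𝔭 he hf x = padicAlgEquiv K p 𝔭 h𝔭 he hf (algebraMap K (𝔭.adicCompletion K) x) :=
  rfl

variable (W : WeierstrassCurve ℚ)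

/-- **The transport of local points `E(K_𝔭) ≃+ E(ℚ_p)`** along `K_𝔭 ≃ₐ[ℚ] ℚ_p` (`(W ⊗ K) ⊗ K_𝔭 = W ⊗ K_𝔭`,
then Mathlib's functorial `Affine.Point.map`, packaged as the tree's `pointEquivOfAlgEquiv`). [folklore] -/
def pointTransportPadic :
    ((W.baseChange K).baseChange (𝔭.adicCompletion K)).toAffine.Point ≃+
      (W.baseChange ℚ_[p]).toAffine.Point :=
  (Affine.Point.congrEquiv
      (LocalIndexSymmetry.baseChange_baseChange W (𝔭.adicCompletion K))).trans
    (pointEquivOfAlgEquiv W (padicAlgEquiv K p 𝔭 h𝔭 he hf))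

/-- **The transport takes the image of `P ∈ E(K)` in `E(K_𝔭)` to `P_ι ∈ E(ℚ_p)`, `ι = embAt K p 𝔭`.**
[folklore] -/
theorem pointTransportPadic_baseChange (P : (W.baseChange K).toAffine.Point) :
    pointTransportPadic K p 𝔭 h𝔭 he hf W
        (Affine.Point.baseChange (W' := W.baseChange K) K (𝔭.adicCompletion K) P) =
      padicPointOf W p (embAt K p 𝔭 h𝔭 he hf) P := by
  rcases P with _ | ⟨x, y, hxy⟩
  · exact (map_zero _).trans (map_zero _).symm
  · -- both sides are affine points; compute coordinates
    have hL : ∀ (a b : 𝔭.adicCompletion K)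
        (hab : ((W.baseChange K).baseChange (𝔭.adicCompletion K)).toAffine.Nonsingular a b),
        ∃ hab', pointTransportPadic K p 𝔭 h𝔭 he hf W (.some a b hab) =
          .some (padicAlgEquiv K p 𝔭 h𝔭 he hf a) (padicAlgEquiv K p 𝔭 h𝔭 he hf b) hab' := by
      intro a b hab
      rw [pointTransportPadic, AddEquiv.trans_apply, Affine.Point.congrEquiv_some]
      exact ⟨_, rfl⟩
    have hns : ((W.baseChange K).baseChange (𝔭.adicCompletion K)).toAffine.Nonsingular
        (algebraMap K (𝔭.adicCompletion K) x) (algebraMap K (𝔭.adicCompletion K) y) :=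
      ((W.baseChange K).toAffine.baseChange_nonsingular
        (f := Algebra.ofId K (𝔭.adicCompletion K)) (RingHom.injective _) x y).mpr hxy
    obtain ⟨hab', hP⟩ := hL (algebraMap K _ x) (algebraMap K _ y) hns
    exact hP

/-- The transport carries `im (E(K) → E(K_𝔭))` onto `im_ι E(K) = {P_ι}` (`ι = embAt`). [folklore] -/
theorem map_range_baseChange :
    (Affine.Point.baseChange (W' := W.baseChange K) K (𝔭.adicCompletion K)).range.map
        (pointTransportPadic K p 𝔭 h𝔭 he hf W).toAddMonoidHom =
      (Affine.Point.map (W' := W) (embAt K p 𝔭 h𝔭 he hf).toRatAlgHom).range := by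
  apply le_antisymm
  · rintro _ ⟨_, ⟨P, rfl⟩, rfl⟩
    exact ⟨P, (pointTransportPadic_baseChange K p 𝔭 h𝔭 he hf W P).symm⟩
  · rintro _ ⟨P, rfl⟩
    exact ⟨_, ⟨P, rfl⟩, pointTransportPadic_baseChange K p 𝔭 h𝔭 he hf W P⟩

/-- The transport carries `nE(K_𝔭)` onto `nE(ℚ_p)`. [folklore] -/
theorem map_range_zsmul (n : ℤ) :
    ((zsmulAddGroupHom n :
        ((W.baseChange K).baseChange (𝔭.adicCompletion K)).toAffine.Point →+ _).range).map
        (pointTransportPadic K p 𝔭 h𝔭 he hf W).toAddMonoidHom =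
      (zsmulAddGroupHom n : (W.baseChange ℚ_[p]).toAffine.Point →+ _).range := by
  set Φ := pointTransportPadic K p 𝔭 h𝔭 he hf W
  apply le_antisymm
  · rintro _ ⟨_, ⟨P, rfl⟩, rfl⟩
    exact ⟨Φ P, by rw [zsmulAddGroupHom_apply, zsmulAddGroupHom_apply]; exact (map_zsmul Φ n P).symm⟩
  · rintro _ ⟨P, rfl⟩
    refine ⟨n • Φ.symm P, ⟨Φ.symm P, rfl⟩, ?_⟩
    change Φ (n • Φ.symm P) = _
    rw [map_zsmul, AddEquiv.apply_symm_apply, zsmulAddGroupHom_apply]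

/-- **Item (iii): `[E(K_𝔭) : nE(K_𝔭) + im E(K)] = [E(ℚ_p) : nE(ℚ_p) + im_ι E(K)]`** — the Part-A / Part-B
local index read in `E(ℚ_p)` through THE embedding `ι = embAt K p 𝔭`. [cite: Castella2018, proof of Thm. 2.3, (calcul) (arXiv:1704.06608 p. 6), "`K_𝔭 = ℚ_p`"] -/
theorem index_range_baseChange_sup_eq_padic (n : ℤ) :
    ((Affine.Point.baseChange (W' := W.baseChange K) K (𝔭.adicCompletion K)).range ⊔
        (zsmulAddGroupHom n :
          ((W.baseChange K).baseChange (𝔭.adicCompletion K)).toAffine.Point →+ _).range).index =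
      ((Affine.Point.map (W' := W) (embAt K p 𝔭 h𝔭 he hf).toRatAlgHom).range ⊔
        (zsmulAddGroupHom n : (W.baseChange ℚ_[p]).toAffine.Point →+ _).range).index := by
  set Φ := pointTransportPadic K p 𝔭 h𝔭 he hf W
  have h := AddSubgroup.index_map_of_bijective (f := Φ.toAddMonoidHom) Φ.bijective
    ((Affine.Point.baseChange (W' := W.baseChange K) K (𝔭.adicCompletion K)).range ⊔
      (zsmulAddGroupHom n :
        ((W.baseChange K).baseChange (𝔭.adicCompletion K)).toAffine.Point →+ _).range)
  rw [AddSubgroup.map_sup, map_range_baseChange, map_range_zsmul] at h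
  exact h.symm

include h𝔭 he hf in
/-- `[E(K_𝔭) : nE(K_𝔭)] = [E(ℚ_p) : nE(ℚ_p)]`. [folklore] -/
theorem index_range_zsmul_eq_padic (n : ℤ) :
    ((zsmulAddGroupHom n :
        ((W.baseChange K).baseChange (𝔭.adicCompletion K)).toAffine.Point →+ _).range).index =
      ((zsmulAddGroupHom n : (W.baseChange ℚ_[p]).toAffine.Point →+ _).range).index := by
  set Φ := pointTransportPadic K p 𝔭 h𝔭 he hf W
  have h := AddSubgroup.index_map_of_bijective (f := Φ.toAddMonoidHom) Φ.bijective
    ((zsmulAddGroupHom n :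
        ((W.baseChange K).baseChange (𝔭.adicCompletion K)).toAffine.Point →+ _).range)
  rw [map_range_zsmul] at h
  exact h.symm

end Transport

/-! ## §2. Item (G4): `E(K_𝔭)[p] = 0 ⟹ E[p^∞](K̄)^{D_𝔭} = 0` -/

section Vanishing

variable {K : Type u} [Field K] [NumberField K] (W : WeierstrassCurve K) (p : ℕ)
  (𝔭 : HeightOneSpectrum (𝓞 K))

/-- **`E(K_𝔭)[p] = 0 ⟹ E[p^∞](K̄)^{D_𝔭} = 0`**: a `p`-primary point fixed by the decomposition group
`D_𝔭` is `0` — by induction on the exponent, peeling one factor `p` at a time with the Galois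
descent lemma `eq_zero_of_fixed_decomp_of_local` (the case `p • m = 0`).
[cite: Castella2018Erratum, Thm. 1.1 (iv)] [cite: GreenbergLNM1716, §2 p. 63] -/
theorem eq_zero_of_forall_decomp_smul_eq
    (hKv : ∀ R : (W.baseChange (𝔭.adicCompletion K)).toAffine.Point, p • R = 0 → R = 0)
    (Q : W.geomPrimaryTorsion p) (hfix : ∀ d ∈ decomp 𝔭, d • Q = Q) : Q = 0 := by
  obtain ⟨n, hn⟩ := (AddCommGroup.mem_primaryComponent).mp Q.2
  have hn' : p ^ n • Q = 0 :=
    Subtype.ext (by rw [AddSubgroupClass.coe_nsmul, hn, ZeroMemClass.coe_zero])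
  clear hn
  induction n generalizing Q with
  | zero => rwa [pow_zero, one_smul] at hn'
  | succ n ih =>
    apply ih Q hfix
    have hfix' : ∀ d ∈ decomp 𝔭, d • (p ^ n • Q) = p ^ n • Q := fun d hd => by
      rw [smul_comm, hfix d hd]
    refine eq_zero_of_fixed_decomp_of_local W p 𝔭 hKv (p ^ n • Q) hfix' ?_
    rw [← mul_smul, ← pow_succ', hn']

/-- **Item (G4) in the shape consumed by `LevelKummer.selmerGroup_acLevelStructure_le_inf`**: if
`E(K_𝔭)[p] = 0` then a point of `E[p^∞](K̄)` fixed by `Γ_{K_𝔭}` — acting through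
`absGaloisRestrict K K_𝔭`, whose image is `D_𝔭 = decomp 𝔭` by definition — is `0`. With (iv)
`E(ℚ_p)[p] = 0` and `K_𝔭 ≅ ℚ_p` (`noPTorsion_baseChange_adicCompletion_of_padic`) this is the
erratum's use of (iv): `H⁰(K_𝔭, E[p^∞]) = 0`. [cite: Castella2018Erratum, Thm. 1.1 (iv)]
[cite: Castella2018, proof of Thm. 2.3, (calcul) (arXiv:1704.06608 p. 6), the factor `#H⁰(K_𝔭, E[p^∞])`] -/
theorem eq_zero_of_forall_restrictField_eq
    (hKv : ∀ R : (W.baseChange (𝔭.adicCompletion K)).toAffine.Point, p • R = 0 → R = 0) :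
    ∀ Q : W.geomPrimaryTorsion p,
      (∀ σ : absoluteGaloisGroup (Place.Completion (Sum.inr 𝔭 : Place K)),
        GaloisRep.restrictField (Place.Completion (Sum.inr 𝔭 : Place K)) (primaryGaloisModule W p)
          σ Q = Q) → Q = 0 := by
  intro Q hQ
  refine eq_zero_of_forall_decomp_smul_eq W p 𝔭 hKv Q fun d hd => ?_
  obtain ⟨σ, rfl⟩ := (mem_decomp_iff 𝔭 d).mp hd
  exact hQ σ

end Vanishing

/-! ## §3. The two primes above a split `p` in a quadratic field -/

section TwoPrimes

variable (K : Type) [Field K] [NumberField K] (p : ℕ) [Fact p.Prime]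

/-- **The primes above a split `p` in a quadratic `K` are `𝔭` and `σ • 𝔭 ≠ 𝔭`** for some
`σ ∈ Aut(K/ℚ)` (the fundamental identity `Σ e f = 2` gives exactly two primes, tree
`placesOver_trichotomy_of_finrank_eq_two`; `Aut(K/ℚ)` is transitive on them,
`HeightOneSpectrum.exists_algEquiv_smul_eq`). [folklore] -/
theorem exists_conj_prime_of_splitsIn (h2 : Module.finrank ℚ K = 2) (hs : SplitsIn K p)
    {𝔭 : HeightOneSpectrum (𝓞 K)} (h𝔭 : ((p : ℕ) : 𝓞 K) ∈ 𝔭.asIdeal) :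
    ∃ (σ : K ≃ₐ[ℚ] K) (𝔮 : HeightOneSpectrum (𝓞 K)), σ • 𝔭 = 𝔮 ∧ 𝔮 ≠ 𝔭 ∧
      ((p : ℕ) : 𝓞 K) ∈ 𝔮.asIdeal ∧
      ∀ v : HeightOneSpectrum (𝓞 K), ((p : ℕ) : 𝓞 K) ∈ v.asIdeal → v = 𝔭 ∨ v = 𝔮 := by
  haveI : Algebra.IsQuadraticExtension ℚ K := ⟨h2⟩
  have hv := under_eq_ratPlace_of_mem h𝔭
  have hcard : {w : HeightOneSpectrum (𝓞 K) | w.under (𝓞 ℚ) = ratPlace p}.ncard = 2 := by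
    rw [← ncard_primesOver_span_eq K (ratPlace p), primesEquiv_ratPlace]
    exact hs
  rcases placesOver_trichotomy_of_finrank_eq_two K h2 (ratPlace p) with
    ⟨w₁, w₂, hne, hset, -⟩ | ⟨w, hset, -, -⟩ | ⟨w, hset, -, -⟩
  · have hmem : ∀ v : HeightOneSpectrum (𝓞 K), ((p : ℕ) : 𝓞 K) ∈ v.asIdeal → v = w₁ ∨ v = w₂ := by
      intro v hpv
      have h : v ∈ {w : HeightOneSpectrum (𝓞 K) | w.under (𝓞 ℚ) = ratPlace p} :=
        under_eq_ratPlace_of_mem hpv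
      rw [hset] at h
      simpa using h
    have hw₁ : ((p : ℕ) : 𝓞 K) ∈ w₁.asIdeal := by
      refine mem_of_under_eq_ratPlace (p := p) ?_
      have : w₁ ∈ ({w₁, w₂} : Set (HeightOneSpectrum (𝓞 K))) := Set.mem_insert _ _
      rw [← hset] at this
      exact this
    have hw₂ : ((p : ℕ) : 𝓞 K) ∈ w₂.asIdeal := by
      refine mem_of_under_eq_ratPlace (p := p) ?_
      have : w₂ ∈ ({w₁, w₂} : Set (HeightOneSpectrum (𝓞 K))) :=
        Set.mem_insert_of_mem _ (Set.mem_singleton _)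
      rw [← hset] at this
      exact this
    -- `𝔮` = the other prime
    obtain ⟨𝔮, h𝔮p, h𝔮ne, h𝔮all⟩ : ∃ 𝔮 : HeightOneSpectrum (𝓞 K), ((p : ℕ) : 𝓞 K) ∈ 𝔮.asIdeal ∧
        𝔮 ≠ 𝔭 ∧ ∀ v : HeightOneSpectrum (𝓞 K), ((p : ℕ) : 𝓞 K) ∈ v.asIdeal → v = 𝔭 ∨ v = 𝔮 := by
      rcases hmem 𝔭 h𝔭 with rfl | rfl
      · exact ⟨w₂, hw₂, hne.symm, hmem⟩
      · exact ⟨w₁, hw₁, hne, fun v hv => (hmem v hv).symm⟩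
    have hunder : 𝔭.under (𝓞 ℚ) = 𝔮.under (𝓞 ℚ) := by
      rw [hv, under_eq_ratPlace_of_mem h𝔮p]
    obtain ⟨σ, hσ⟩ := HeightOneSpectrum.exists_algEquiv_smul_eq (F := ℚ) hunder
    exact ⟨σ, 𝔮, hσ, h𝔮ne, h𝔮p, h𝔮all⟩
  · rw [hset, Set.ncard_singleton] at hcard; exact absurd hcard (by norm_num)
  · rw [hset, Set.ncard_singleton] at hcard; exact absurd hcard (by norm_num)

end TwoPrimes

/-! ## §4. Item (v): `ord_p ∏_{w ∣ p} c_w(E/K) = 2 · ord_p c_p(E)` -/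

section Tamagawa

variable (W : WeierstrassCurve ℚ) [W.IsElliptic] (K : Type) [Field K] [NumberField K] (p : ℕ)
  [Fact p.Prime]

omit [W.IsElliptic] in
/-- Transport of `c_u(E)` along an equality of places of `ℚ`. [folklore] -/
private theorem localTamagawaNumber_congr {u u' : HeightOneSpectrum (𝓞 ℚ)} (h : u = u') :
    (W.baseChange (u.adicCompletion ℚ)).localTamagawaNumber (u.adicCompletionIntegers ℚ) =
      (W.baseChange (u'.adicCompletion ℚ)).localTamagawaNumber (u'.adicCompletionIntegers ℚ) := by
  subst h
  rfl

/-- **`c_w(E/K) = c_p(E)` at a degree-one `w ∣ p`** (`c_p` the `ℤ_p`-Tamagawa number of `W ⊗ ℚ_p`):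
the tree's `localTamagawaNumber_baseChange_eq_of_degree_one` (`K_w ≅ ℚ_v`) and
`localTamagawaNumber_padic_eq_holds` (`ℚ_v ≅ ℚ_[p]`). Castella 2018 §5: "`c_w = c_w̄ = c_ℓ(E)` at a
split `ℓ`". [cite: Castella2018, §5 (arXiv:1704.06608 p. 12), Tamagawa relation]
[cite: SilvermanAEC2009, VII.6 Ex. 7.6] -/
theorem localTamagawaNumber_eq_padic_of_degree_one {w : HeightOneSpectrum (𝓞 K)}
    (hw : ((p : ℕ) : 𝓞 K) ∈ w.asIdeal) (he : w.asIdeal.ramificationIdx (𝓞 ℚ) = 1)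
    (hf : w.asIdeal.inertiaDeg (𝓞 ℚ) = 1) :
    ((W.baseChange K).baseChange (w.adicCompletion K)).localTamagawaNumber
        (w.adicCompletionIntegers K) =
      (W.baseChange ℚ_[p]).localTamagawaNumber ℤ_[p] := by
  rw [localTamagawaNumber_baseChange_eq_of_degree_one W w he hf,
    localTamagawaNumber_congr W (under_eq_ratPlace_of_mem hw),
    localTamagawaNumber_padic_eq_holds W (ratPlace p) p (primesEquiv_ratPlace p)]

/-- **Item (v): `ord_p ∏_{w ∣ p} c_w(E/K) = 2 · ord_p c_p(E)`** for a quadratic `K` in which `p`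
splits (`p = 𝔭𝔭̄`, both of degree one, `c_𝔭 = c_𝔭̄ = c_p(E)`): the Tamagawa term of Cas18 Thm. 2.3
/ JSW17 (7.1.5) at the places above `p` is `c_p(E)²` up to `p`-adic units.
[cite: Castella2018, Thm. 2.3 and §5 (arXiv:1704.06608 pp. 5, 12)]
[cite: JetchevSkinnerWan2017, §7.1 (7.1.4)–(7.1.5) (arXiv:1512.06894 pp. 15–16)] -/
theorem padicValNat_tamagawaProductAbove_eq_two_mul (h2 : Module.finrank ℚ K = 2)
    (hs : SplitsIn K p) :
    padicValNat p (tamagawaProductAbove W K p) =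
      2 * padicValNat p ((W.baseChange ℚ_[p]).localTamagawaNumber ℤ_[p]) := by
  haveI hEK : (W.baseChange K).IsElliptic := by rw [baseChange]; infer_instance
  obtain ⟨𝔭, h𝔭, -, -⟩ := exists_degreeOnePrime_of_splitsIn K p h2 hs
  obtain ⟨-, 𝔮, -, h𝔮ne, h𝔮, hall⟩ := exists_conj_prime_of_splitsIn K p h2 hs h𝔭
  set cK : HeightOneSpectrum (𝓞 K) → ℕ := fun w =>
    ((W.baseChange K).baseChange (w.adicCompletion K)).localTamagawaNumber
      (w.adicCompletionIntegers K) with hcK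
  set a : HeightOneSpectrum (𝓞 K) → ℕ := fun w =>
    if ((p : ℕ) : 𝓞 K) ∈ w.asIdeal then cK w else 1 with ha
  have hsupp : Function.mulSupport a ⊆ ↑({𝔭, 𝔮} : Finset (HeightOneSpectrum (𝓞 K))) := by
    intro w hw
    rw [Function.mem_mulSupport] at hw
    by_cases hpw : ((p : ℕ) : 𝓞 K) ∈ w.asIdeal
    · rw [Finset.coe_insert, Finset.coe_singleton]
      rcases hall w hpw with rfl | rfl
      · exact Set.mem_insert _ _
      · exact Set.mem_insert_of_mem _ (Set.mem_singleton _)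
    · exact (hw (by simp only [ha, hpw, if_false])).elim
  have hprod : tamagawaProductAbove W K p = cK 𝔭 * cK 𝔮 := by
    change (∏ᶠ w, a w) = _
    rw [finprod_eq_prod_of_mulSupport_subset a hsupp, Finset.prod_pair h𝔮ne.symm]
    simp only [ha, h𝔭, h𝔮, if_true]
  have hc𝔭 : cK 𝔭 = (W.baseChange ℚ_[p]).localTamagawaNumber ℤ_[p] :=
    localTamagawaNumber_eq_padic_of_degree_one W K p h𝔭 (degreeOne_of_splitsIn h2 hs h𝔭).1
      (degreeOne_of_splitsIn h2 hs h𝔭).2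
  have hc𝔮 : cK 𝔮 = (W.baseChange ℚ_[p]).localTamagawaNumber ℤ_[p] :=
    localTamagawaNumber_eq_padic_of_degree_one W K p h𝔮 (degreeOne_of_splitsIn h2 hs h𝔮).1
      (degreeOne_of_splitsIn h2 hs h𝔮).2
  have hc0 : (W.baseChange ℚ_[p]).localTamagawaNumber ℤ_[p] ≠ 0 := by
    rw [← hc𝔭]; exact (W.baseChange K).localTamagawaNumber_baseChange_ne_zero 𝔭
  rw [hprod, hc𝔭, hc𝔮, padicValNat.mul hc0 hc0]
  ring

end Tamagawa

end Summit.BirchSwinnertonDyer.Rank1Residual.X11b.LocalIndexTransport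

end
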